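import Mathlib
import Summits.HodgeConjecture.FermatCycles.HodgeFermatTheoremU
import Summits.HodgeConjecture.FermatCycles.HodgeFermatLemmaWFourier
import Summits.HodgeConjecture.FermatCycles.HodgeFermatTheoremUPlus

/-!
# LEMMA W with a variable support bound: `LemmaWk N k`, its Fourier proof from `k·#bad(N) < φ(N)`, and `s(N) ≤ U(N)` (`HodgeFermat/LemmaWk.lean` + `LemmaWkFourier.lean` + `BadCountBound.lean`; HF-G27b)

Tree copy of 3 SMALL MODULES of the sibling cell's standalone package `run/shared/lean/pub/pub-hodgefermat/lean/HodgeFermat/`,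
concatenated IN DEPENDENCY ORDER in one tree file (each module's body byte-identical to its source lines, its own `namespace … end`
block kept; the precedent is `HodgeFermatPropDPrimeNFinal.lean`) — the analytic half of GATE HF-G27b (pub-hodgefermat `CERT.md` l.915):
  1. `HodgeFermat/LemmaWk.lean` (54 lines, sha256 `c23397a320584cc1…`), source lines 18–54 (all: `LemmaWk N k` — LEMMA W with support
     bound `k`; `LemmaWk N 12` is the landed `TheoremU.LemmaW N` on the nose, `lemmaWk_twelve_iff := Iff.rfl` —, `lemmaWk_mono`, `lemmaWk_zero`);
  2. `HodgeFermat/LemmaWkFourier.lean` (122 lines, sha256 `b78eba07b2a58ffb…`), source lines 18–117 (`coreK` — the uncertainty-principle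
     step with support bound `k` —, `lemmaWk_of_badCount : 1 < N → k * badCount N < N.totient → LemmaWk N k`) — cell record
     `check/LemmaWk_standalone.lean` rc 0;
  3. `HodgeFermat/BadCountBound.lean` (54 lines, sha256 `185638304fc319ed…`), source lines 20–48 (`two_mul_badCount_le` — `s(N) ≤ U(N)`:
     `2 · badCount N ≤ Σ_{p ∣ N} tauP N p` at every level `N > 1`, HYPOTHESIS H0 discharged by the landed `HurwitzZero.hypH0` —,
     `badCount_lt_of_tauP`) — cell record `check/BadCountBound_standalone.lean` rc 0.
Filed by cell `pub-hfermat`, seat prover-1 gen-5, on the COORDINATOR KEEPER RULING of 2026-08-25 (gem sweep H1: take the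
off-gate kernel theorem `thmFstar` through the gate; every form of THEOREM F* is on-gate since 2026-08-25/26, gen-0/2/3/4), as
successor work of the same verbatim-port kind: the sibling's off-gate gate records HF-G27 / HF-G27b / HF-G27c — COROLLARY U′
(all-unit Hodge multisets with few distinct residues are sums of pairs), its printed-threshold forms U♯, and THEOREM U in
shared-entry form — on top of the landed LEMMA W / THEOREM U / U⁺ / U⁼ chain (`HodgeFermatTheoremU.lean`,
`HodgeFermatLemmaWFourier.lean`, `HodgeFermatTheoremUPlus.lean`, `HodgeFermatTheoremUEq.lean`, `HodgeFermatPropDPrimeNFinal.lean`).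
Deviations from the source modules, exhaustively: the `import` lines (tree modules `…HodgeFermatTheoremU` for `import HodgeFermat.TheoremU`,
`…HodgeFermatLemmaWFourier` for `import HodgeFermat.LemmaWFourier`, `…HodgeFermatTheoremUPlus` for `import HodgeFermat.TheoremUPlus` — it carries
`HypUPlus.tauP`/`GoodP`/`two_mul_card_oddK_leP` and, through `HodgeFermatD6OneFile.lean`, `HypBReduction.badSet_subset`/`oddK` and
`HurwitzZero.hypH0` —; module 2's `import HodgeFermat.LemmaWk` points inside this file); this docstring (replacing the modules' docstrings,
all quoted below); TWO DEDUP deletions (pre-empting the gate's `dedup.landed`; both are the sources' own «is the case k = …»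
re-derivations of LANDED theorems, used nowhere): module 2's `theorem lemmaW_of_badCount'` (source l.118–120) restates
`HodgeFermat.KRFree.LemmaWFourier.lemmaW_of_badCount` (`HodgeFermatLemmaWFourier.lean`), module 3's `theorem bad_lt_of_goodP'` (source
l.49–52) restates `HodgeFermat.KRFree.HypUPlus.bad_lt_of_goodP` (`HodgeFermatTheoremUPlus.lean`).  Every other line — in particular every
declaration's statement and proof — is byte-identical to its source.
Trust base: no hypotheses beyond the displayed binders, no `sorry`; axioms = [propext, Classical.choice, Quot.sound].
HONEST FRAMING: explicit algebraic cycles for specific Hodge classes on Fermat/Delsarte varieties; residual open instances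
listed; no claim on general Hodge.  (This file is arithmetic of CM types / finite combinatorics of the sibling's KR-free
programme; it claims nothing about cycles.)

(1) The docstring of `HodgeFermat/LemmaWk.lean` (l.6–16), verbatim:

## LEMMA W with a variable support bound (`LemmaWk N k`) — statement (HF-G27b)

`TheoremU.LemmaW N` is LEMMA W of `tables/SEMI-THEOREM.md` §2 with the support bound `12` that THEOREM U needs
(two triples and their negatives).  COROLLARY U′ in its printed form ("if `#supp(v) < 1/s(m)` then `v` is a sum of
pairs") needs the same lemma with an ARBITRARY support bound `k`, under the counting hypothesis `k · #bad(N) < φ(N)`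
in place of `12 · #bad(N) < φ(N)`: this light module states it (`LemmaWk N k`; `LemmaWk N 12` is `LemmaW N` on the
nose, `lemmaWk_twelve_iff`), `LemmaWkFourier.lean` proves `k · #bad(N) < φ(N) → LemmaWk N k` by the Fourier argument
of `LemmaWFourier.lean` (whose `pointwise_bound` is support-free), and `CorollaryUSharp.lean` derives the multiset
statements with threshold `k` from `LemmaWk N (2k)`.

(2) The docstring of `HodgeFermat/LemmaWkFourier.lean` (l.7–16), verbatim:

## LEMMA W_k from `k · #bad(N) < φ(N)` — the Fourier argument with a variable support bound (HF-G27b)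

`LemmaWFourier.core` / `lemmaW_of_badCount` (generation 22) with the constant `12` replaced by a parameter `k`:
the uncertainty-principle step is `φ(N) · L ≤ #supp · #bad · L` (`LemmaWFourier.pointwise_bound`, summed over the
support), so ANY support bound `k` with `k · #bad(N) < φ(N)` forces an odd weight on the units with vanishing residue
transform to be zero.  `coreK`, `lemmaWk_of_badCount : 1 < N → k * badCount N < N.totient → LemmaWk N k`;
generation 22's `lemmaW_of_badCount` is the case `k = 12` (`lemmaW_of_badCount'`).  Used by `CorollaryUSharpFinal.lean`
(COROLLARY U′ with the printed thresholds `1/s(N)`, `1/U(N)`).  No `sorry`; axioms `[propext, Classical.choice, Quot.sound]`.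

(3) The docstring of `HodgeFermat/BadCountBound.lean` (l.6–18), verbatim:

## `s(N) ≤ U(N)` in the kernel: `2 · #bad(N) ≤ Σ_{p ∣ N} τ⁺(N, p)` at every level (HF-G27b)

`tables/SEMI-THEOREM.md` §2 measures the bad odd characters by `s(m) = #{bad odd χ} / (φ(m)/2)` and bounds it by the
explicit `U(m) = Σ_{p ∣ m} τ_p`.  In the kernel `#{bad odd χ} = badCount N` (`LemmaWFourier`) and
`U(N) · φ(N) = Σ_{p ∈ N.primeFactors} tauP N p` (`HypUPlus.tauP`, `τ` read modulo the general cofactor `n_p = N / p^(v_p)`);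
the inequality `s(N) ≤ U(N)`, i.e. `2 · badCount N ≤ Σ_p tauP N p`, is the content of generation 26's `bad_lt_of_goodP`
(there specialised to the constant `6`): `badSet N ⊆ ⋃_p oddK N p` (`HypBReduction.badSet_subset`, HYPOTHESIS H0 discharged
by `HurwitzZero.hypH0`) and `2 · #oddK N p ≤ tauP N p` (`two_mul_card_oddK_leP`).  Stated here once with no constant,
so that COROLLARY U′ with the threshold `1/U(N)` (`CorollaryUSharpFinal.lean`) can use any `k`:
`k · Σ_p tauP N p < φ(N) → 2·k · badCount N < φ(N)` (`badCount_lt_of_tauP`).  Hub record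
`check/BadCountBound_standalone.lean` (the 26 light bodies of `check/ThmUPlusLight_standalone.lean` + this module).
-/

-- ════════════════════════════════════════════════════════════════════════════════════════════════
-- module 1/3: HodgeFermat/LemmaWk.lean (source lines 18–54)
-- ════════════════════════════════════════════════════════════════════════════════════════════════

set_option autoImplicit false

namespace HodgeFermat.KRFree.LemmaWSupp

open Finset HodgeFermat.KRFree.TheoremU

/-- LEMMA W_k at level `N`: an integer weight `w` on the units of `ℤ/N` (zero off `[0, N)` and off the units) which
is ODD (`w(N − x) = −w(x)`), is supported on AT MOST `k` residues, and whose residue transform vanishes at every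
unit `t`, is identically zero.  (`LemmaW N` is the case `k = 12`.) -/
def LemmaWk (N k : ℕ) : Prop :=
  ∀ w : ℕ → ℤ,
    (∀ x, N ≤ x → w x = 0) →
    (∀ x, ¬ Nat.Coprime x N → w x = 0) →
    (∀ x, 0 < x → x < N → w (N - x) = - w x) →
    ((Finset.range N).filter (fun x => w x ≠ 0)).card ≤ k →
    (∀ t, Nat.Coprime t N → resTransform N w t = 0) →
    ∀ x, w x = 0

/-- `LemmaWk N 12` is literally `LemmaW N`. -/
theorem lemmaWk_twelve_iff (N : ℕ) : LemmaWk N 12 ↔ LemmaW N := Iff.rfl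

/-- monotonicity in the support bound -/
theorem lemmaWk_mono {N k k' : ℕ} (hk : k ≤ k') (h : LemmaWk N k') : LemmaWk N k :=
  fun w h1 h2 h3 h4 h5 => h w h1 h2 h3 (h4.trans hk) h5

/-- the trivial case: support bound `0` -/
theorem lemmaWk_zero (N : ℕ) : LemmaWk N 0 := by
  intro w h1 _ _ h4 _ x
  rcases Nat.lt_or_ge x N with hx | hx
  · by_contra hne
    have hmem : x ∈ (Finset.range N).filter (fun x => w x ≠ 0) :=
      Finset.mem_filter.mpr ⟨Finset.mem_range.mpr hx, hne⟩
    have := Finset.card_pos.mpr ⟨x, hmem⟩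
    omega
  · exact h1 x hx

end HodgeFermat.KRFree.LemmaWSupp

-- ════════════════════════════════════════════════════════════════════════════════════════════════
-- module 2/3: HodgeFermat/LemmaWkFourier.lean (source lines 18–117)
-- ════════════════════════════════════════════════════════════════════════════════════════════════

set_option autoImplicit false

namespace HodgeFermat.KRFree.LemmaWSupp

open Finset HodgeFermat.KRFree.TheoremU HodgeFermat.KRFree.LemmaWFourier

section coreK

variable {N : ℕ} [NeZero N] (f : ZMod N → ℂ)

/-- The uncertainty-principle step with support bound `k`: an odd weight on the units with at most `k`-point support
and vanishing residue transform is zero as soon as `k · #bad < φ(N)`. -/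
theorem coreK (k : ℕ) (hunit : ∀ a, ¬ IsUnit a → f a = 0) (hodd : ∀ a, f (-a) = - f a)
    (hsupp : (Finset.univ.filter (fun a => f a ≠ 0)).card ≤ k)
    (htr : ∀ u : (ZMod N)ˣ, ∑ a : ZMod N, f a * ((((u : ZMod N) * a).val : ℕ) : ℂ) = 0)
    (hbad : k * (badSet N).card < N.totient) : ∀ a, f a = 0 := by
  set L : ℝ := ∑ a : ZMod N, ‖f a‖ with hLdef
  have hL : 0 ≤ L := Finset.sum_nonneg (fun a _ => norm_nonneg _)
  -- φ · L ≤ #supp · #bad · L ≤ k · #bad · L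
  have hsum : L = ∑ a ∈ Finset.univ.filter (fun a => f a ≠ 0), ‖f a‖ := by
    rw [hLdef, Finset.sum_filter_of_ne]
    intro a _ ha
    exact norm_ne_zero_iff.mp ha
  have key : (N.totient : ℝ) * L ≤ (k : ℝ) * ((badSet N).card : ℝ) * L := by
    calc (N.totient : ℝ) * L
        = ∑ a ∈ Finset.univ.filter (fun a => f a ≠ 0), (N.totient : ℝ) * ‖f a‖ := by
          rw [hsum, Finset.mul_sum]
      _ ≤ ∑ a ∈ Finset.univ.filter (fun a => f a ≠ 0), ((badSet N).card : ℝ) * L :=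
          Finset.sum_le_sum (fun a _ => pointwise_bound f hunit hodd htr a)
      _ = ((Finset.univ.filter (fun a => f a ≠ 0)).card : ℝ) * (((badSet N).card : ℝ) * L) := by
          rw [Finset.sum_const, nsmul_eq_mul]
      _ ≤ (k : ℝ) * (((badSet N).card : ℝ) * L) := by
          refine mul_le_mul_of_nonneg_right ?_ (mul_nonneg (Nat.cast_nonneg _) hL)
          exact_mod_cast hsupp
      _ = (k : ℝ) * ((badSet N).card : ℝ) * L := by ring
  have hbad' : (k : ℝ) * ((badSet N).card : ℝ) < (N.totient : ℝ) := by exact_mod_cast hbad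
  have hL0 : L = 0 := by
    by_contra hne
    have hpos : 0 < L := lt_of_le_of_ne hL (Ne.symm hne)
    have := lt_of_lt_of_le (mul_lt_mul_of_pos_right hbad' hpos) key
    exact lt_irrefl _ this
  have hall : ∀ a ∈ (Finset.univ : Finset (ZMod N)), ‖f a‖ = 0 :=
    (Finset.sum_eq_zero_iff_of_nonneg (fun a _ => norm_nonneg _)).mp (by rw [← hLdef]; exact hL0)
  intro a
  exact norm_eq_zero.mp (hall a (Finset.mem_univ a))

end coreK

/-- **LEMMA W_k at level `N > 1` follows from `k · #bad(N) < φ(N)`.** -/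
theorem lemmaWk_of_badCount {N k : ℕ} (hN : 1 < N) (hbad : k * badCount N < N.totient) : LemmaWk N k := by
  haveI : NeZero N := ⟨by omega⟩
  intro w hw1 hw2 hw3 hw4 hw5 x
  set f : ZMod N → ℂ := fun a => ((w a.val : ℤ) : ℂ) with hf
  have w0 : w 0 = 0 := hw2 0 (by
    intro h
    have := Nat.coprime_zero_left N |>.mp h
    omega)
  have hunit : ∀ a, ¬ IsUnit a → f a = 0 := by
    intro a ha
    have hc : ¬ Nat.Coprime a.val N := by
      intro hc
      apply ha
      rw [← ZMod.natCast_zmod_val a]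
      exact (ZMod.isUnit_iff_coprime a.val N).mpr hc
    simp [hf, hw2 _ hc]
  have hodd : ∀ a, f (-a) = - f a := by
    intro a
    by_cases ha : a = 0
    · subst ha; simp [hf, w0]
    · have hv : (-a).val = N - a.val := by rw [ZMod.neg_val, if_neg ha]
      have hpos : 0 < a.val := Nat.pos_of_ne_zero (fun h => ha ((ZMod.val_eq_zero a).mp h))
      simp only [hf, hv]
      rw [hw3 _ hpos (ZMod.val_lt a)]
      push_cast; ring
  have hsupp : (Finset.univ.filter (fun a => f a ≠ 0)).card ≤ k := by
    refine le_trans ?_ hw4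
    refine Finset.card_le_card_of_injOn (fun a => a.val) (fun a ha => ?_) ?_
    · have ha' : f a ≠ 0 := (Finset.mem_filter.mp (Finset.mem_coe.mp ha)).2
      refine Finset.mem_coe.mpr (Finset.mem_filter.mpr ⟨Finset.mem_range.mpr (ZMod.val_lt a), ?_⟩)
      intro h0; apply ha'; simp [hf, h0]
    · intro a _ b _ h
      exact ZMod.val_injective N h
  have htr : ∀ u : (ZMod N)ˣ, ∑ a : ZMod N, f a * ((((u : ZMod N) * a).val : ℕ) : ℂ) = 0 := by
    intro u
    have h := hw5 (u : ZMod N).val (ZMod.val_coe_unit_coprime u)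
    unfold resTransform at h
    rw [sum_range_eq_sum_zmod N] at h
    have h' := congrArg (Int.cast : ℤ → ℂ) h
    simp only [Int.cast_sum, Int.cast_mul, Int.cast_natCast, Int.cast_zero] at h'
    rw [← h']
    refine Finset.sum_congr rfl (fun a _ => ?_)
    simp only [hf, ZMod.val_mul]
  have hbad2 : k * (badSet N).card < N.totient := by rwa [badCount_eq] at hbad
  have hz := coreK f k hunit hodd hsupp htr hbad2
  by_cases hx : x < N
  · have h1 := hz (x : ZMod N)
    simp only [hf, ZMod.val_natCast, Nat.mod_eq_of_lt hx, Int.cast_eq_zero] at h1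
    exact h1
  · exact hw1 x (by omega)

-- `theorem lemmaW_of_badCount'` (source l.118–120, «generation 22's `lemmaW_of_badCount` is the case `k = 12`»): NOT re-declared —
-- its statement is the landed `HodgeFermat.KRFree.LemmaWFourier.lemmaW_of_badCount` (DEDUP).

end HodgeFermat.KRFree.LemmaWSupp

-- ════════════════════════════════════════════════════════════════════════════════════════════════
-- module 3/3: HodgeFermat/BadCountBound.lean (source lines 20–48)
-- ════════════════════════════════════════════════════════════════════════════════════════════════

set_option autoImplicit false

namespace HodgeFermat.KRFree.BadCountBound

open Finset HodgeFermat.KRFree.HypBReduction HodgeFermat.KRFree.LemmaWFourier HodgeFermat.KRFree.HurwitzZero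
open HodgeFermat.KRFree.HypUPlus

/-- **`s(N) ≤ U(N)`**: at every level `N > 1`, twice the number of bad odd characters mod `N` is at most
`Σ_{p ∣ N} τ⁺(N, p)`. -/
theorem two_mul_badCount_le (N : ℕ) (h1 : 1 < N) :
    2 * badCount N ≤ ∑ p ∈ N.primeFactors, tauP N p := by
  haveI : NeZero N := ⟨by omega⟩
  rw [badCount_eq]
  have hcard : (badSet N).card ≤ ∑ p ∈ N.primeFactors, (oddK N p).card :=
    (Finset.card_le_card (badSet_subset hypH0 N)).trans Finset.card_biUnion_le
  have hsum : 2 * ∑ p ∈ N.primeFactors, (oddK N p).card ≤ ∑ p ∈ N.primeFactors, tauP N p := by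
    rw [Finset.mul_sum]
    exact Finset.sum_le_sum (fun p hp => two_mul_card_oddK_leP N p hp)
  omega

/-- hence a level inequality `k · Σ_p τ⁺(N,p) < φ(N)` (i.e. `k < 1/U(N)`) gives the counting hypothesis
`2k · #bad(N) < φ(N)` (i.e. `k < 1/s(N)`) of LEMMA W_{2k}. -/
theorem badCount_lt_of_tauP (N k : ℕ) (h1 : 1 < N) (h : k * ∑ p ∈ N.primeFactors, tauP N p < N.totient) :
    2 * k * badCount N < N.totient := by
  have hb := Nat.mul_le_mul_left k (two_mul_badCount_le N h1)
  have e : 2 * k * badCount N = k * (2 * badCount N) := by ring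
  rw [e]
  exact lt_of_le_of_lt hb h

-- `theorem bad_lt_of_goodP'` (source l.49–52, «generation 26's `bad_lt_of_goodP` is the case `k = 6`»): NOT re-declared —
-- its statement is the landed `HodgeFermat.KRFree.HypUPlus.bad_lt_of_goodP` (DEDUP).

end HodgeFermat.KRFree.BadCountBound
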